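import Mathlib.Analysis.SpecialFunctions.Integrals.Basic
import Mathlib.MeasureTheory.Integral.IntervalIntegral.IntegrationByParts
import Mathlib.MeasureTheory.Integral.IntegralEqImproper
import Mathlib.Analysis.Calculus.ContDiff.Deriv
import HarnessLib

/-!
# One-dimensional integrations by parts behind the energy identity of the polar model operator
([Elgindi2021] §7.1, Proposition 7.1 Step 2)

Topic `Literature/Analysis/FluidPDE`. Proof file (everything proved, no definitions, no named
facts) on the proof path of the named fact
`Literature.Analysis.FluidPDE.Elgindi.ElgindiGhoulMasmoudi2021_stabilityCore`
(`ElgindiStabilityDecomposition.lean`). T. M. Elgindi, Ann. of Math. 194 (2021) =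
arXiv:1904.04795, §7.1 proof of Proposition 7.1, Step 2 (p. 19):

> "Multiplying (PolarBSL) by `Ψ` and integrating we get
> `α²|R∂_RΨ|² − α²|Ψ|² + (α(5+α)/2)|Ψ|² + |∂_θΨ|² − 6|Ψ|² + ½|sec(θ)Ψ|² = (F,Ψ)`."

The four one-dimensional identities this display is made of, for the a-priori class (`C²`
functions; compact support in `R`; in `θ` the profile is `u = cosθ·χ`, so that `u(π/2) = 0`,
`∂_θ(tanθ·u) = ∂_θ(sinθ·χ)` is smooth and `sec(θ)u = χ`):
* `∫₀^∞(−R²v″)v dR = ∫₀^∞R²v′² − ∫₀^∞v²` (`integral_Ioi_neg_sq_mul_deriv2_mul`),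
* `∫₀^∞(−Rv′)v dR = ½∫₀^∞v²` (`integral_Ioi_neg_mul_deriv_mul`),
* `∫₀^{π/2}(−u″)u dθ = ∫₀^{π/2}u′²` for `u(0) = u(π/2) = 0` (`integral_neg_deriv2_mul_dirichlet`),
* `∫₀^{π/2}∂_θ(sinθχ)·cosθχ dθ = ½∫₀^{π/2}χ²` (`integral_tanTerm_mul`).
-/

noncomputable section

open MeasureTheory Set Real Filter intervalIntegral
open _root_.Topology

namespace Literature.Analysis.FluidPDE

namespace Elgindi

/-! ### The angular identities -/

/-- `∫₀^{π/2}(−u″)u = ∫₀^{π/2}u′²` for `u ∈ C²(ℝ)` with `u(0) = u(π/2) = 0`. [cite: Elgindi2021, §7.1 proof of Proposition 7.1 Step 2 ("|∂_θΨ|²") (p. 19 of arXiv:1904.04795)] -/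
theorem integral_neg_deriv2_mul_dirichlet {u : ℝ → ℝ} (hu : ContDiff ℝ 2 u) (h0 : u 0 = 0) (h1 : u (π / 2) = 0) :
    ∫ θ in (0 : ℝ)..(π / 2), -deriv (deriv u) θ * u θ = ∫ θ in (0 : ℝ)..(π / 2), deriv u θ ^ 2 := by
  have hd1 : Differentiable ℝ u := hu.differentiable (by simp)
  have hu1 : ContDiff ℝ 1 (deriv u) := by have := hu.iterate_deriv' 1 1; simpa using this
  have hd2 : Differentiable ℝ (deriv u) := hu1.differentiable (by simp)
  have hc0 := hu.continuous
  have hc1 := hu1.continuous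
  have hc2 : Continuous (deriv (deriv u)) := hu1.continuous_deriv le_rfl
  -- `(u u')' = u'² + u u''`
  have hder : ∀ θ ∈ Set.uIcc (0 : ℝ) (π / 2), HasDerivAt (fun θ => u θ * deriv u θ)
      (deriv u θ ^ 2 + u θ * deriv (deriv u) θ) θ := fun θ _ =>
    ((hd1 θ).hasDerivAt.mul (hd2 θ).hasDerivAt).congr_deriv (by ring)
  have hFTC := integral_eq_sub_of_hasDerivAt hder ((by fun_prop : Continuous fun θ =>
    deriv u θ ^ 2 + u θ * deriv (deriv u) θ).intervalIntegrable _ _)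
  simp only [h0, h1, zero_mul, sub_zero] at hFTC
  have i1 : IntervalIntegrable (fun θ => deriv u θ ^ 2) volume 0 (π / 2) := (hc1.pow 2).intervalIntegrable _ _
  have i2 : IntervalIntegrable (fun θ => u θ * deriv (deriv u) θ) volume 0 (π / 2) := (hc0.mul hc2).intervalIntegrable _ _
  rw [intervalIntegral.integral_add i1 i2] at hFTC
  have e : ∫ θ in (0 : ℝ)..(π / 2), -deriv (deriv u) θ * u θ = -∫ θ in (0 : ℝ)..(π / 2), u θ * deriv (deriv u) θ := by
    rw [← intervalIntegral.integral_neg]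
    exact intervalIntegral.integral_congr fun θ _ => by ring
  rw [e]
  linarith

/-- **The `tan`-term against the profile**: with `u = cosθ·χ` (`χ ∈ C¹(ℝ)`),
`∂_θ(tanθ·u)·u = (cosθχ + sinθχ′)cosθχ` and `∫₀^{π/2}(cosθχ + sinθχ′)cosθχ dθ = ½∫₀^{π/2}χ²`
("`+ ½|sec(θ)Ψ|²`"). [cite: Elgindi2021, §7.1 proof of Proposition 7.1 Step 2 (p. 19 of arXiv:1904.04795)] -/
theorem integral_tanTerm_mul {χ : ℝ → ℝ} (hχ : ContDiff ℝ 1 χ) :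
    ∫ θ in (0 : ℝ)..(π / 2), (Real.cos θ * χ θ + Real.sin θ * deriv χ θ) * (Real.cos θ * χ θ) =
      (1 / 2) * ∫ θ in (0 : ℝ)..(π / 2), χ θ ^ 2 := by
  have hd : Differentiable ℝ χ := hχ.differentiable (by simp)
  have hc0 := hχ.continuous
  have hc1 : Continuous (deriv χ) := hχ.continuous_deriv le_rfl
  -- `(½ sin cos χ²)' = ½(cos² − sin²)χ² + sin cos χ χ'`
  have hder : ∀ θ ∈ Set.uIcc (0 : ℝ) (π / 2), HasDerivAt (fun θ => (1 / 2) * (Real.sin θ * Real.cos θ * χ θ ^ 2))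
      ((1 / 2) * ((Real.cos θ ^ 2 - Real.sin θ ^ 2) * χ θ ^ 2) + Real.sin θ * Real.cos θ * χ θ * deriv χ θ) θ := by
    intro θ _
    have hs := Real.hasDerivAt_sin θ
    have hc := Real.hasDerivAt_cos θ
    have e2 : (fun θ => χ θ ^ 2) = fun θ => χ θ * χ θ := by funext θ; ring
    have h2 : HasDerivAt (fun θ => χ θ ^ 2) (2 * χ θ * deriv χ θ) θ := by
      rw [e2]; exact ((hd θ).hasDerivAt.mul (hd θ).hasDerivAt).congr_deriv (by ring)
    have hsc : HasDerivAt (fun θ => Real.sin θ * Real.cos θ) (Real.cos θ * Real.cos θ + Real.sin θ * -Real.sin θ) θ := hs.mul hc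
    have h := (hsc.mul h2).const_mul (1 / 2)
    exact h.congr_deriv (by ring)
  have hFTC := integral_eq_sub_of_hasDerivAt hder ((by fun_prop : Continuous fun θ =>
    (1 / 2) * ((Real.cos θ ^ 2 - Real.sin θ ^ 2) * χ θ ^ 2) + Real.sin θ * Real.cos θ * χ θ * deriv χ θ).intervalIntegrable _ _)
  simp only [Real.sin_zero, Real.cos_pi_div_two, zero_mul, mul_zero, sub_zero] at hFTC
  -- pointwise: integrand = ½χ² + [½(cos² − sin²)χ² + sin cos χ χ']  (using sin² + cos² = 1)
  have e : ∀ θ, (Real.cos θ * χ θ + Real.sin θ * deriv χ θ) * (Real.cos θ * χ θ) =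
      (1 / 2) * χ θ ^ 2 + ((1 / 2) * ((Real.cos θ ^ 2 - Real.sin θ ^ 2) * χ θ ^ 2) +
        Real.sin θ * Real.cos θ * χ θ * deriv χ θ) := by
    intro θ
    have := Real.sin_sq_add_cos_sq θ
    linear_combination (1 / 2 * χ θ ^ 2) * this
  simp_rw [e]
  have i1 : IntervalIntegrable (fun θ => (1 / 2) * χ θ ^ 2) volume 0 (π / 2) := ((hc0.pow 2).const_mul _).intervalIntegrable _ _
  have i2 : IntervalIntegrable (fun θ => (1 / 2) * ((Real.cos θ ^ 2 - Real.sin θ ^ 2) * χ θ ^ 2) +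
      Real.sin θ * Real.cos θ * χ θ * deriv χ θ) volume 0 (π / 2) := (by fun_prop : Continuous fun θ =>
    (1 / 2) * ((Real.cos θ ^ 2 - Real.sin θ ^ 2) * χ θ ^ 2) + Real.sin θ * Real.cos θ * χ θ * deriv χ θ).intervalIntegrable _ _
  rw [intervalIntegral.integral_add i1 i2, hFTC, intervalIntegral.integral_const_mul]
  ring

/-! ### The radial identities -/

/-- `∫₀^∞(−Rv′)v dR = ½∫₀^∞v²` for `v ∈ C¹(ℝ)` vanishing for `R ≥ b`. [cite: Elgindi2021, §7.1 proof of Proposition 7.1 Step 2 ("(α(5+α)/2)|Ψ|²") (p. 19 of arXiv:1904.04795)] -/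
theorem integral_Ioi_neg_mul_deriv_mul {v : ℝ → ℝ} (hv : ContDiff ℝ 1 v) {b : ℝ} (hb0 : 0 ≤ b)
    (hb : ∀ R, b ≤ R → v R = 0) :
    ∫ R in Ioi (0 : ℝ), -(R * deriv v R) * v R = (1 / 2) * ∫ R in Ioi (0 : ℝ), v R ^ 2 := by
  have hd : Differentiable ℝ v := hv.differentiable (by simp)
  have hc0 := hv.continuous
  have hc1 : Continuous (deriv v) := hv.continuous_deriv le_rfl
  have hdb : ∀ R, b < R → deriv v R = 0 := by
    intro R hR
    have : v =ᶠ[𝓝 R] fun _ => 0 := Filter.eventuallyEq_of_mem (Ioi_mem_nhds hR) fun s hs => hb s hs.le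
    rw [this.deriv_eq, deriv_const]
  -- reduce both sides to `[0, b]`
  have hzero1 : ∀ R, b < R → -(R * deriv v R) * v R = 0 := fun R hR => by rw [hb R hR.le]; ring
  have hzero2 : ∀ R, b < R → v R ^ 2 = 0 := fun R hR => by rw [hb R hR.le]; ring
  have red : ∀ (g : ℝ → ℝ), Continuous g → (∀ R, b < R → g R = 0) → ∫ R in Ioi (0 : ℝ), g R = ∫ R in (0 : ℝ)..b, g R := by
    intro g _ hgz
    rw [intervalIntegral.integral_of_le hb0]
    exact setIntegral_eq_of_subset_of_forall_sdiff_eq_zero measurableSet_Ioi Ioc_subset_Ioi_self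
      fun R hR => hgz R (not_le.1 fun h => hR.2 ⟨hR.1, h⟩)
  rw [red _ (by fun_prop) hzero1, red _ (by fun_prop) hzero2]
  -- FTC for `(½ R v²)' = ½v² + R v v'`
  have hder : ∀ R ∈ Set.uIcc (0 : ℝ) b, HasDerivAt (fun R => (1 / 2) * (R * v R ^ 2))
      ((1 / 2) * v R ^ 2 + R * deriv v R * v R) R := by
    intro R _
    have e2 : (fun R => v R ^ 2) = fun R => v R * v R := by funext R; ring
    have h2 : HasDerivAt (fun R => v R ^ 2) (2 * v R * deriv v R) R := by
      rw [e2]; exact ((hd R).hasDerivAt.mul (hd R).hasDerivAt).congr_deriv (by ring)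
    have h := ((hasDerivAt_id' R).mul h2).const_mul (1 / 2)
    exact h.congr_deriv (by simp; ring)
  have hFTC := integral_eq_sub_of_hasDerivAt hder ((by fun_prop : Continuous fun R =>
    (1 / 2) * v R ^ 2 + R * deriv v R * v R).intervalIntegrable _ _)
  norm_num [hb b le_rfl] at hFTC
  have i1 : IntervalIntegrable (fun R => (1 / 2) * v R ^ 2) volume 0 b := ((hc0.pow 2).const_mul _).intervalIntegrable _ _
  have i2 : IntervalIntegrable (fun R => R * deriv v R * v R) volume 0 b := (by fun_prop : Continuous fun R =>
    R * deriv v R * v R).intervalIntegrable _ _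
  rw [intervalIntegral.integral_add i1 i2, intervalIntegral.integral_const_mul] at hFTC
  have e : ∫ R in (0 : ℝ)..b, -(R * deriv v R) * v R = -∫ R in (0 : ℝ)..b, R * deriv v R * v R := by
    rw [← intervalIntegral.integral_neg]
    exact intervalIntegral.integral_congr fun R _ => by ring
  rw [e]
  linarith

/-- `∫₀^∞(−R²v″)v dR = ∫₀^∞(Rv′)² − ∫₀^∞v²` for `v ∈ C²(ℝ)` vanishing for `R ≥ b`. [cite: Elgindi2021, §7.1 proof of Proposition 7.1 Step 2 ("α²|R∂_RΨ|² − α²|Ψ|²") (p. 19 of arXiv:1904.04795)] -/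
theorem integral_Ioi_neg_sq_mul_deriv2_mul {v : ℝ → ℝ} (hv : ContDiff ℝ 2 v) {b : ℝ} (hb0 : 0 ≤ b)
    (hb : ∀ R, b ≤ R → v R = 0) :
    ∫ R in Ioi (0 : ℝ), -(R ^ 2 * deriv (deriv v) R) * v R =
      (∫ R in Ioi (0 : ℝ), (R * deriv v R) ^ 2) - ∫ R in Ioi (0 : ℝ), v R ^ 2 := by
  have hd1 : Differentiable ℝ v := hv.differentiable (by simp)
  have hv1 : ContDiff ℝ 1 (deriv v) := by have := hv.iterate_deriv' 1 1; simpa using this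
  have hd2 : Differentiable ℝ (deriv v) := hv1.differentiable (by simp)
  have hc0 := hv.continuous
  have hc1 := hv1.continuous
  have hc2 : Continuous (deriv (deriv v)) := hv1.continuous_deriv le_rfl
  have hdb : ∀ R, b < R → deriv v R = 0 := by
    intro R hR
    have : v =ᶠ[𝓝 R] fun _ => 0 := Filter.eventuallyEq_of_mem (Ioi_mem_nhds hR) fun s hs => hb s hs.le
    rw [this.deriv_eq, deriv_const]
  have hddb : ∀ R, b < R → deriv (deriv v) R = 0 := by
    intro R hR
    have : deriv v =ᶠ[𝓝 R] fun _ => 0 := Filter.eventuallyEq_of_mem (Ioi_mem_nhds hR) fun s hs => hdb s hs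
    rw [this.deriv_eq, deriv_const]
  have red : ∀ (g : ℝ → ℝ), Continuous g → (∀ R, b < R → g R = 0) → ∫ R in Ioi (0 : ℝ), g R = ∫ R in (0 : ℝ)..(b + 1), g R := by
    intro g _ hgz
    rw [intervalIntegral.integral_of_le (by linarith)]
    exact setIntegral_eq_of_subset_of_forall_sdiff_eq_zero measurableSet_Ioi Ioc_subset_Ioi_self
      fun R hR => hgz R (by by_contra h; exact hR.2 ⟨hR.1, by linarith [not_lt.1 h]⟩)
  rw [red _ (by fun_prop) (fun R hR => by rw [hb R hR.le]; ring), red _ (by fun_prop) (fun R hR => by rw [hdb R hR]; ring),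
    red _ (by fun_prop) (fun R hR => by rw [hb R hR.le]; ring)]
  -- the first step of `integral_Ioi_neg_mul_deriv_mul` on `[0, b+1]`: `∫ R v' v = -½ ∫ v²`
  have hderA : ∀ R ∈ Set.uIcc (0 : ℝ) (b + 1), HasDerivAt (fun R => (1 / 2) * (R * v R ^ 2))
      ((1 / 2) * v R ^ 2 + R * deriv v R * v R) R := by
    intro R _
    have e2 : (fun R => v R ^ 2) = fun R => v R * v R := by funext R; ring
    have h2 : HasDerivAt (fun R => v R ^ 2) (2 * v R * deriv v R) R := by
      rw [e2]; exact ((hd1 R).hasDerivAt.mul (hd1 R).hasDerivAt).congr_deriv (by ring)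
    have h := ((hasDerivAt_id' R).mul h2).const_mul (1 / 2)
    exact h.congr_deriv (by simp; ring)
  have hA := integral_eq_sub_of_hasDerivAt hderA ((by fun_prop : Continuous fun R =>
    (1 / 2) * v R ^ 2 + R * deriv v R * v R).intervalIntegrable _ _)
  norm_num [hb (b + 1) (by linarith)] at hA
  have iA1 : IntervalIntegrable (fun R => (1 / 2) * v R ^ 2) volume 0 (b + 1) := ((hc0.pow 2).const_mul _).intervalIntegrable _ _
  have iA2 : IntervalIntegrable (fun R => R * deriv v R * v R) volume 0 (b + 1) := (by fun_prop : Continuous fun R =>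
    R * deriv v R * v R).intervalIntegrable _ _
  rw [intervalIntegral.integral_add iA1 iA2, intervalIntegral.integral_const_mul] at hA
  -- `(R² v v')' = 2R v v' + R² v'² + R² v v''`
  have hderB : ∀ R ∈ Set.uIcc (0 : ℝ) (b + 1), HasDerivAt (fun R => R ^ 2 * (v R * deriv v R))
      (2 * R * (v R * deriv v R) + R ^ 2 * (deriv v R * deriv v R + v R * deriv (deriv v) R)) R := by
    intro R _
    have h1 : HasDerivAt (fun R : ℝ => R ^ 2) (2 * R) R := by
      have e : (fun R : ℝ => R ^ 2) = fun R => R * R := by funext R; ring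
      rw [e]; exact ((hasDerivAt_id' R).mul (hasDerivAt_id' R)).congr_deriv (by ring)
    have h2 := (hd1 R).hasDerivAt.mul (hd2 R).hasDerivAt
    exact (h1.mul h2).congr_deriv (by simp)
  have hB := integral_eq_sub_of_hasDerivAt hderB ((by fun_prop : Continuous fun R =>
    2 * R * (v R * deriv v R) + R ^ 2 * (deriv v R * deriv v R + v R * deriv (deriv v) R)).intervalIntegrable _ _)
  norm_num [hb (b + 1) (by linarith)] at hB
  have i1 : IntervalIntegrable (fun R => 2 * R * (v R * deriv v R)) volume 0 (b + 1) := (by fun_prop : Continuous fun R =>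
    2 * R * (v R * deriv v R)).intervalIntegrable _ _
  have i2 : IntervalIntegrable (fun R => R ^ 2 * (deriv v R * deriv v R + v R * deriv (deriv v) R)) volume 0 (b + 1) :=
    (by fun_prop : Continuous fun R => R ^ 2 * (deriv v R * deriv v R + v R * deriv (deriv v) R)).intervalIntegrable _ _
  rw [intervalIntegral.integral_add i1 i2] at hB
  have e1 : ∫ R in (0 : ℝ)..(b + 1), 2 * R * (v R * deriv v R) = 2 * ∫ R in (0 : ℝ)..(b + 1), R * deriv v R * v R := by
    rw [← intervalIntegral.integral_const_mul]
    exact intervalIntegral.integral_congr fun R _ => by ring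
  have i3 : IntervalIntegrable (fun R => (R * deriv v R) ^ 2) volume 0 (b + 1) := (by fun_prop : Continuous fun R =>
    (R * deriv v R) ^ 2).intervalIntegrable _ _
  have i4 : IntervalIntegrable (fun R => R ^ 2 * deriv (deriv v) R * v R) volume 0 (b + 1) := (by fun_prop : Continuous fun R =>
    R ^ 2 * deriv (deriv v) R * v R).intervalIntegrable _ _
  have e2 : ∫ R in (0 : ℝ)..(b + 1), R ^ 2 * (deriv v R * deriv v R + v R * deriv (deriv v) R) =
      (∫ R in (0 : ℝ)..(b + 1), (R * deriv v R) ^ 2) + ∫ R in (0 : ℝ)..(b + 1), R ^ 2 * deriv (deriv v) R * v R := by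
    rw [← intervalIntegral.integral_add i3 i4]
    exact intervalIntegral.integral_congr fun R _ => by ring
  have e3 : ∫ R in (0 : ℝ)..(b + 1), -(R ^ 2 * deriv (deriv v) R) * v R = -∫ R in (0 : ℝ)..(b + 1), R ^ 2 * deriv (deriv v) R * v R := by
    rw [← intervalIntegral.integral_neg]
    exact intervalIntegral.integral_congr fun R _ => by ring
  rw [e1, e2] at hB
  rw [e3]
  linarith

end Elgindi

end Literature.Analysis.FluidPDE
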